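import Mathlib.Analysis.SpecialFunctions.Complex.CircleAddChar
import Mathlib.NumberTheory.LegendreSymbol.AddCharacter
import Mathlib.LinearAlgebra.UnitaryGroup
import Mathlib.Algebra.MvPolynomial.PDeriv
import Mathlib.Algebra.MvPolynomial.Monad
import Mathlib.Algebra.MvPolynomial.Equiv
import Mathlib.Data.ZMod.Basic
import HarnessLib

/-!
# Polynomial-phase circuits: QFTs and polynomial phase kicks on `r` registers `ℤ/N`

Topic `Computability/QuantumComplexity`. A *polynomial-phase circuit* on `r` registers, each
carrying the Hilbert space `ℂ^{ℤ/N}` with standard basis `|u⟩, u ∈ ℤ/N`, is a word in two kinds of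
gates:

* `qft j` — the quantum Fourier transform over `ℤ_N` on register `j` (a *partial QFT* in the
  terminology of Van den Nest 2013, §2): `F_j |u⟩ = N^{-1/2} ∑_{t ∈ ℤ/N} e(u_j t / N) |u[j := t]⟩`,
  `e(z/N) := exp(2πi z/N)`;
* `kick P` — the diagonal *polynomial phase gate* of an integer polynomial `P ∈ ℤ[x_1,…,x_r]`:
  `D_P |u⟩ = e(P(u)/N) |u⟩` (Van den Nest's quadratic phase gates `ξ(g) = e(P(g)/N)`, `deg P ≤ 2`,
  are the normalizer-circuit special case; here the degree is arbitrary).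

This file gives the syntax (`PolyPhaseGate`, `PolyPhaseCircuit = List`), the matrix semantics
(`gateMatrix`, `unitary` = product of the gate matrices in circuit order, `amplitude C x y = ⟨y|U_C|x⟩`,
all PROVED unitary), the gate-by-gate recursion of amplitudes, and the closed FEYNMAN PATH SUM
(sum over intermediate register contents, folklore; cf. Dawson et al. 2005 for the `ℤ₂` analogue):

  `⟨y|U_C|x⟩ = [x_j = y_j on registers never Fourier-transformed] · N^{-#qft/2} · ∑_v e(Φ_C(x, y, v)/N)`

with ONE summation variable per QFT gate that is not the last QFT on its register, and the *path
phase* `Φ_C ∈ ℤ[X_j, Y_j, V_n]` (`pathPhase`, a symbolic polynomial in input symbols `X_j`, output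
symbols `Y_j` and path variables `V_n`, numbered in order of creation) accumulated as: every kick
contributes `P` evaluated at the current register contents, every QFT on register `j` contributes
`(old content of j) · (new content of j)`, the new content being a fresh variable, or `Y_j` for the
last QFT on `j` (`amplitude_eq_pathSum`, `amplitude_eq_zero_of_not_compatible`).

For the 2-adic registers `N = 4^c` of route QuantumAdvantage/TwoAdicStationaryPhase we add the
convenience layer: `qftNorm (4^c) = 2^{-c}`, the reduction `halfRed : ℤ/4^c → ℤ/2^c`, the
least-residue lift `liftHalf`, the criticality predicate `IsCritical` (all partial derivatives
`∂Φ_C/∂V_n` vanish mod `2^c` — the critical set of the periodized stationary phase of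
Dąbrowski–Fisher / Fisher, as used by Kocia–Love 2021 §5 Thm 1 at `p` odd), `firstVar`, and the
one-register alternating word `chain k P = D_{P_0} F D_{P_1} F ⋯ D_{P_k} F` whose amplitude is the
chain sum written verbatim in that route (`amplitude_chain`).

## Design notes

* General modulus `N` (`[NeZero N]`), normalisation `qftNorm N = (√N)⁻¹` per QFT; this covers the
  even (`4^c`) and odd (`2·4^c`) register sizes of the route at once.
* `e(z/N)` is written literally as `Complex.exp (2π i z.val / N)` (`echar`) and bridged to Mathlib's
  `ZMod.stdAddChar` (`echar_eq_stdAddChar`) for additivity and orthogonality.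
* Circuits are lists, HEAD APPLIED FIRST: `unitary (g :: C) = unitary C * gateMatrix g`.
* NOT here: complexity classes, uniformity, the stationary-phase identities themselves (route items).

## References

* M. Van den Nest, *Efficient classical simulations of quantum Fourier transforms and normalizer
  circuits over Abelian groups*, QIC 13 (2013), §2 [Vandennest2013].
* L. Kocia, P. Love, *Stationary phase method in discrete Wigner functions and classical simulation
  of quantum circuits*, Quantum 5 (2021), §5 Thm 1 [KociaLove2021].
* C. M. Dawson et al., *Quantum computing and polynomial equations over `ℤ₂`*, QIC 5 (2005)
  [DawsonEtAl2005].
* M. A. Nielsen, I. L. Chuang, *Quantum Computation and Quantum Information*, CUP 2010, §5.1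
  [NielsenChuang2010].
-/

noncomputable section

open Complex Matrix
open scoped Real

namespace Literature.Computability.QuantumComplexity

/-- **Gates of a polynomial-phase circuit on `r` registers `ℤ/N`**: `qft j` is the quantum Fourier
transform over `ℤ_N` applied to register `j` (a partial QFT), `kick P` is the diagonal phase gate
`|u⟩ ↦ e(P(u)/N)|u⟩` of an integer polynomial `P` in the `r` register variables (arbitrary degree;
degree `≤ 2` gives Van den Nest's quadratic phase gates). [cite: Vandennest2013, §2] -/
inductive PolyPhaseGate (r : ℕ) : Type
  /-- the QFT over `ℤ_N` on register `j`. -/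
  | qft (j : Fin r) : PolyPhaseGate r
  /-- the polynomial phase kick `|u⟩ ↦ e(P(u)/N) |u⟩`. -/
  | kick (P : MvPolynomial (Fin r) ℤ) : PolyPhaseGate r

/-- **Polynomial-phase circuits** on `r` registers: words in `PolyPhaseGate r`, the HEAD of the list
being the gate applied FIRST. [cite: Vandennest2013, §2] -/
abbrev PolyPhaseCircuit (r : ℕ) : Type := List (PolyPhaseGate r)

namespace PolyPhaseCircuit

open PolyPhaseGate MvPolynomial

variable {r : ℕ}

/-! ### The character `e(z/N)` and the QFT normalisation -/

section Char

variable (N : ℕ)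

/-- `e(z/N) := exp(2πi z/N)` for `z ∈ ℤ/N`, written through the least-residue representative
`z.val` (the literal form used by route statements). [folklore] -/
def echar (z : ZMod N) : ℂ := Complex.exp (2 * Real.pi * Complex.I * ((z.val : ℂ) / (N : ℂ)))

/-- The per-QFT normalisation `N^{-1/2}`. [cite: Vandennest2013, §2] -/
def qftNorm : ℂ := ((Real.sqrt N)⁻¹ : ℝ)

/-- `qftNorm N · qftNorm N = 1/N`. [folklore] -/
theorem qftNorm_mul_self : qftNorm N * qftNorm N = ((N : ℂ))⁻¹ := by
  have h : (Real.sqrt N)⁻¹ * (Real.sqrt N)⁻¹ = ((N : ℝ))⁻¹ := by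
    rw [← mul_inv, Real.mul_self_sqrt (Nat.cast_nonneg N)]
  unfold qftNorm
  rw [← Complex.ofReal_mul, h]
  push_cast
  rfl

variable [NeZero N]

/-- `e(·/N)` is Mathlib's standard additive character of `ℤ/N`. [folklore] -/
theorem echar_eq_stdAddChar (z : ZMod N) : echar N z = ZMod.stdAddChar z := by
  rw [ZMod.stdAddChar_apply, ZMod.toCircle_apply, echar]
  congr 1
  ring

/-- Additivity `e((a+b)/N) = e(a/N) e(b/N)`. [folklore] -/
theorem echar_add (a b : ZMod N) : echar N (a + b) = echar N a * echar N b := by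
  simp only [echar_eq_stdAddChar, AddChar.map_add_eq_mul]

/-- `e(0) = 1`. [folklore] -/
@[simp] theorem echar_zero : echar N 0 = 1 := by
  simp [echar_eq_stdAddChar]

/-- `|e(z/N)| = 1`. [folklore] -/
theorem norm_echar (z : ZMod N) : ‖echar N z‖ = 1 := by
  rw [echar_eq_stdAddChar, ZMod.stdAddChar_apply, Circle.norm_coe]

/-- `conj e(z/N) = e(-z/N)`. [folklore] -/
theorem conj_echar (z : ZMod N) : (starRingEnd ℂ) (echar N z) = echar N (-z) := by
  rw [echar_eq_stdAddChar, echar_eq_stdAddChar, AddChar.map_neg_eq_conj]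

/-- `e(z/N) · conj e(z/N) = 1`. [folklore] -/
theorem echar_mul_conj (z : ZMod N) : echar N z * (starRingEnd ℂ) (echar N z) = 1 := by
  rw [Complex.mul_conj, Complex.normSq_eq_norm_sq, norm_echar]
  simp

/-- **Orthogonality of characters of `ℤ/N`**: `∑_t e(t s/N) = N·[s = 0]`. [folklore] -/
theorem sum_echar_mul (s : ZMod N) :
    ∑ t : ZMod N, echar N (t * s) = if s = 0 then (N : ℂ) else 0 := by
  simp_rw [echar_eq_stdAddChar]
  rw [AddChar.sum_mulShift _ (ZMod.isPrimitive_stdAddChar N), ZMod.card, Nat.cast_ite, Nat.cast_zero]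

/-- On the 2-adic registers `ℤ/4^c` the QFT normalisation is exactly `2^{-c}`. [folklore] -/
theorem qftNorm_four_pow (c : ℕ) : qftNorm (4 ^ c) = ((2 : ℂ) ^ c)⁻¹ := by
  have h : Real.sqrt ((4 ^ c : ℕ) : ℝ) = 2 ^ c := by
    have : ((4 ^ c : ℕ) : ℝ) = ((2 : ℝ) ^ c) ^ 2 := by
      push_cast
      rw [← pow_mul, mul_comm, pow_mul]
      norm_num
    rw [this]
    exact Real.sqrt_sq (by positivity)
  unfold qftNorm
  rw [h]
  push_cast
  rfl

/-- `e(z/4^c)` in the literal form of the route statements (denominator `(4 : ℂ)^c`). [folklore] -/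
theorem echar_four_pow (c : ℕ) (z : ZMod (4 ^ c)) :
    echar (4 ^ c) z = Complex.exp (2 * Real.pi * Complex.I * ((z.val : ℂ) / (4 ^ c : ℂ))) := by
  rw [echar]
  push_cast
  rfl

end Char

/-! ### Matrix semantics -/

section Semantics

variable (N : ℕ) [NeZero N]

/-- **The matrix of a gate** on the basis `|u⟩, u : Fin r → ℤ/N` (row index = output `u'`, column
index = input `u`): `⟨u'|D_P|u⟩ = [u' = u] e(P(u)/N)` and
`⟨u'|F_j|u⟩ = [u'_i = u_i for i ≠ j] · N^{-1/2} e(u_j u'_j/N)`. [cite: Vandennest2013, §2] -/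
def gateMatrix : PolyPhaseGate r → Matrix (Fin r → ZMod N) (Fin r → ZMod N) ℂ
  | kick P => Matrix.diagonal fun u => echar N (MvPolynomial.aeval u P)
  | qft j => Matrix.of fun u' u =>
      if (∀ i, i ≠ j → u' i = u i) then qftNorm N * echar N (u j * u' j) else 0

/-- **The unitary of a circuit**: the product of its gate matrices in circuit order, the head of the
list acting first (`U_{g :: C} = U_C · U_g`). [folklore] -/
def unitary : PolyPhaseCircuit r → Matrix (Fin r → ZMod N) (Fin r → ZMod N) ℂ
  | [] => 1
  | g :: C => unitary C * gateMatrix N g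

/-- **Transition amplitude** `⟨y|U_C|x⟩` of the circuit `C` between basis states. [folklore] -/
def amplitude (C : PolyPhaseCircuit r) (x y : Fin r → ZMod N) : ℂ := unitary N C y x

variable {N}

/-- The empty circuit is the identity: `⟨y|1|x⟩ = δ_{xy}`. [folklore] -/
theorem amplitude_nil (x y : Fin r → ZMod N) :
    amplitude N ([] : PolyPhaseCircuit r) x y = if x = y then 1 else 0 := by
  simp only [amplitude, unitary, Matrix.one_apply, eq_comm]

/-- Composition: `⟨y|U_C U_g|x⟩ = ∑_u ⟨u|U_g|x⟩ ⟨y|U_C|u⟩`. [folklore] -/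
theorem amplitude_cons (g : PolyPhaseGate r) (C : PolyPhaseCircuit r) (x y : Fin r → ZMod N) :
    amplitude N (g :: C) x y = ∑ u, gateMatrix N g u x * amplitude N C u y := by
  simp only [amplitude, unitary, Matrix.mul_apply]
  exact Finset.sum_congr rfl fun u _ => mul_comm _ _

/-- A kick multiplies the amplitude by its phase: `⟨y|U_C D_P|x⟩ = e(P(x)/N) ⟨y|U_C|x⟩`. [folklore] -/
theorem amplitude_cons_kick (P : MvPolynomial (Fin r) ℤ) (C : PolyPhaseCircuit r)
    (x y : Fin r → ZMod N) :
    amplitude N (kick P :: C) x y = echar N (MvPolynomial.aeval x P) * amplitude N C x y := by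
  rw [amplitude_cons]
  simp only [gateMatrix]
  rw [Finset.sum_eq_single x]
  · rw [Matrix.diagonal_apply_eq]
  · intro u _ hu
    rw [Matrix.diagonal_apply_ne _ hu, zero_mul]
  · intro h
    exact absurd (Finset.mem_univ x) h

/-- Reindexing the states that agree with `x` off register `j` by the content of register `j`.
[folklore] -/
theorem sum_ite_agree {β : Type*} [AddCommMonoid β] (x : Fin r → ZMod N) (j : Fin r)
    (f : (Fin r → ZMod N) → β) :
    (∑ u : Fin r → ZMod N, if (∀ i, i ≠ j → u i = x i) then f u else 0) =
      ∑ t : ZMod N, f (Function.update x j t) := by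
  classical
  rw [← Finset.sum_filter]
  have h : (Finset.univ.filter fun u : Fin r → ZMod N => ∀ i, i ≠ j → u i = x i) =
      Finset.univ.map ⟨Function.update x j, Function.update_injective x j⟩ := by
    ext u
    simp only [Finset.mem_filter, Finset.mem_univ, true_and, Finset.mem_map,
      Function.Embedding.coeFn_mk]
    constructor
    · intro hu
      refine ⟨u j, ?_⟩
      rw [Function.update_eq_iff]
      exact ⟨rfl, fun i hi => (hu i hi).symm⟩
    · rintro ⟨t, rfl⟩ i hi
      exact Function.update_of_ne hi _ _
  rw [h, Finset.sum_map]
  rfl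

/-- **A QFT on register `j` Fourier-sums over the new content of that register**:
`⟨y|U_C F_j|x⟩ = N^{-1/2} ∑_t e(x_j t/N) ⟨y|U_C|x[j := t]⟩`. [folklore] -/
theorem amplitude_cons_qft (j : Fin r) (C : PolyPhaseCircuit r) (x y : Fin r → ZMod N) :
    amplitude N (qft j :: C) x y =
      qftNorm N * ∑ t : ZMod N, echar N (x j * t) * amplitude N C (Function.update x j t) y := by
  rw [amplitude_cons]
  simp only [gateMatrix, Matrix.of_apply, ite_mul, zero_mul]
  rw [sum_ite_agree, Finset.mul_sum]
  refine Finset.sum_congr rfl fun t _ => ?_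
  simp only [Function.update_self, mul_assoc]

/-- **Sanity: a single kick** `⟨y|D_P|x⟩ = δ_{xy} e(P(x)/N)`. [folklore] -/
theorem amplitude_kick (P : MvPolynomial (Fin r) ℤ) (x y : Fin r → ZMod N) :
    amplitude N [kick P] x y = if x = y then echar N (MvPolynomial.aeval x P) else 0 := by
  rw [amplitude_cons_kick, amplitude_nil]
  split_ifs <;> simp

/-- **Sanity: a single QFT is the Fourier kernel on its register**:
`⟨y|F_j|x⟩ = [x_i = y_i, i ≠ j] · N^{-1/2} e(x_j y_j/N)`. [cite: Vandennest2013, §2] -/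
theorem amplitude_qft (j : Fin r) (x y : Fin r → ZMod N) :
    amplitude N [qft j] x y =
      if (∀ i, i ≠ j → x i = y i) then qftNorm N * echar N (x j * y j) else 0 := by
  rw [amplitude_cons_qft]
  simp only [amplitude_nil, mul_ite, mul_one, mul_zero]
  by_cases h : ∀ i, i ≠ j → x i = y i
  · rw [if_pos h]
    rw [Finset.sum_eq_single (y j)]
    · rw [if_pos]
      rw [Function.update_eq_iff]
      exact ⟨rfl, fun i hi => h i hi⟩
    · intro t _ ht
      rw [if_neg]
      intro htx
      exact ht (by rw [← htx, Function.update_self])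
    · intro hy
      exact absurd (Finset.mem_univ _) hy
  · rw [if_neg h]
    convert mul_zero (qftNorm N)
    refine Finset.sum_eq_zero fun t _ => ?_
    rw [if_neg]
    intro htx
    apply h
    intro i hi
    rw [← htx, Function.update_of_ne hi]

/-! ### Unitarity -/

/-- Every gate matrix is unitary (kicks: unit-modulus diagonal; QFT: character orthogonality on
`ℤ/N`). [cite: Vandennest2013, §2] -/
theorem gateMatrix_mem_unitaryGroup (g : PolyPhaseGate r) :
    gateMatrix N g ∈ Matrix.unitaryGroup (Fin r → ZMod N) ℂ := by
  rw [Matrix.mem_unitaryGroup_iff]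
  cases g with
  | kick P =>
    simp only [gateMatrix, Matrix.star_eq_conjTranspose, Matrix.diagonal_conjTranspose,
      Matrix.diagonal_mul_diagonal]
    rw [← Matrix.diagonal_one]
    congr 1
    funext u
    exact echar_mul_conj N _
  | qft j =>
    ext u' u''
    simp only [gateMatrix, Matrix.mul_apply, Matrix.star_eq_conjTranspose,
      Matrix.conjTranspose_apply, Matrix.of_apply, Matrix.one_apply]
    by_cases hagree : ∀ i, i ≠ j → u' i = u'' i
    · -- the two rows agree off `j`: orthogonality in the `j`-th coordinate
      have hrw : ∀ u : Fin r → ZMod N,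
          (if (∀ i, i ≠ j → u' i = u i) then qftNorm N * echar N (u j * u' j) else 0) *
            star (if (∀ i, i ≠ j → u'' i = u i) then qftNorm N * echar N (u j * u'' j) else 0) =
          if (∀ i, i ≠ j → u i = u' i) then
            qftNorm N * qftNorm N * echar N (u j * (u' j - u'' j)) else 0 := by
        intro u
        by_cases hu : ∀ i, i ≠ j → u i = u' i
        · have h1 : ∀ i, i ≠ j → u' i = u i := fun i hi => (hu i hi).symm
          have h2 : ∀ i, i ≠ j → u'' i = u i := fun i hi => (hagree i hi).symm.trans (hu i hi).symm
          rw [if_pos h1, if_pos h2, if_pos hu, star_mul', Complex.star_def, conj_echar, mul_sub,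
            sub_eq_add_neg, echar_add]
          have hq : (starRingEnd ℂ) (qftNorm N) = qftNorm N := by
            unfold qftNorm; exact Complex.conj_ofReal _
          rw [hq]; ring
        · have h1 : ¬ ∀ i, i ≠ j → u' i = u i := fun h => hu fun i hi => (h i hi).symm
          rw [if_neg h1, if_neg hu, zero_mul]
      simp_rw [hrw]
      rw [sum_ite_agree]
      simp only [Function.update_self, ← Finset.mul_sum]
      rw [sum_echar_mul, qftNorm_mul_self]
      by_cases hj : u' j = u'' j
      · have huu : u' = u'' := by
          funext i
          by_cases hi : i = j
          · rw [hi]; exact hj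
          · exact hagree i hi
        rw [if_pos (sub_eq_zero.mpr hj), if_pos huu]
        exact inv_mul_cancel₀ (Nat.cast_ne_zero.mpr (NeZero.ne N))
      · have huu : u' ≠ u'' := fun h => hj (by rw [h])
        rw [if_neg (fun h => hj (sub_eq_zero.mp h)), if_neg huu, mul_zero]
    · -- the rows differ off `j`: every summand vanishes
      have huu : u' ≠ u'' := fun h => hagree fun i _ => by rw [h]
      rw [if_neg huu]
      refine Finset.sum_eq_zero fun u _ => ?_
      by_cases h1 : ∀ i, i ≠ j → u' i = u i
      · have h2 : ¬ ∀ i, i ≠ j → u'' i = u i :=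
          fun h2 => hagree fun i hi => (h1 i hi).trans (h2 i hi).symm
        rw [if_neg h2, star_zero, mul_zero]
      · rw [if_neg h1, zero_mul]

/-- **`U_C` is unitary.** [folklore] -/
theorem unitary_mem_unitaryGroup (C : PolyPhaseCircuit r) :
    unitary N C ∈ Matrix.unitaryGroup (Fin r → ZMod N) ℂ := by
  induction C with
  | nil => exact Submonoid.one_mem _
  | cons g C ih => exact Submonoid.mul_mem _ ih (gateMatrix_mem_unitaryGroup g)

end Semantics

/-! ### Combinatorics of the gate list -/

/-- Does the circuit contain a QFT on register `j`? (Bool-valued, structural.) [folklore] -/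
def hasQft (j : Fin r) : PolyPhaseCircuit r → Bool
  | [] => false
  | qft i :: C => decide (i = j) || hasQft j C
  | kick _ :: C => hasQft j C

/-- Number of QFT gates `#F`. [folklore] -/
def numQft : PolyPhaseCircuit r → ℕ
  | [] => 0
  | qft _ :: C => numQft C + 1
  | kick _ :: C => numQft C

/-- Number of PATH VARIABLES `K`: one per QFT gate that is not the last QFT on its register
(`K = #F − r'`, `r'` the number of registers hit by at least one QFT, cf. `numQft_eq`). [folklore] -/
def numVars : PolyPhaseCircuit r → ℕ
  | [] => 0
  | qft j :: C => if hasQft j C then numVars C + 1 else numVars C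
  | kick _ :: C => numVars C

/-- Number `r'` of registers hit by at least one QFT. [folklore] -/
def numHit (C : PolyPhaseCircuit r) : ℕ := (Finset.univ.filter fun j => C.hasQft j = true).card

/-- The empty word has no QFT. [folklore] -/
@[simp] theorem hasQft_nil (j : Fin r) : hasQft j ([] : PolyPhaseCircuit r) = false := rfl

/-- Kicks do not count as QFTs. [folklore] -/
@[simp] theorem hasQft_cons_kick (j : Fin r) (P : MvPolynomial (Fin r) ℤ) (C : PolyPhaseCircuit r) :
    hasQft j (kick P :: C) = hasQft j C := rfl

/-- Unfolding `hasQft` at a QFT gate. [folklore] -/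
theorem hasQft_cons_qft (j i : Fin r) (C : PolyPhaseCircuit r) :
    hasQft j (qft i :: C) = (decide (i = j) || hasQft j C) := rfl

/-- A word starting with `qft j` hits register `j`. [folklore] -/
@[simp] theorem hasQft_cons_qft_self (j : Fin r) (C : PolyPhaseCircuit r) :
    hasQft j (qft j :: C) = true := by
  simp [hasQft_cons_qft]

/-- A leading QFT on another register does not matter for register `j`. [folklore] -/
theorem hasQft_cons_qft_of_ne {j i : Fin r} (h : i ≠ j) (C : PolyPhaseCircuit r) :
    hasQft j (qft i :: C) = hasQft j C := by
  simp [hasQft_cons_qft, h]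

/-- `hasQft j C` says exactly that the gate `qft j` occurs in `C`. [folklore] -/
theorem hasQft_eq_true_iff (j : Fin r) (C : PolyPhaseCircuit r) :
    hasQft j C = true ↔ qft j ∈ C := by
  induction C with
  | nil => simp
  | cons g C ih =>
    cases g with
    | qft i =>
      rw [hasQft_cons_qft, Bool.or_eq_true, decide_eq_true_eq, ih, List.mem_cons]
      constructor
      · rintro (h | h)
        · exact Or.inl (by rw [h])
        · exact Or.inr h
      · rintro (h | h)
        · exact Or.inl (by cases h; rfl)
        · exact Or.inr h
    | kick P =>
      rw [hasQft_cons_kick, ih, List.mem_cons]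
      simp

/-- **`#F = K + r'`**: the QFT gates are the path variables plus one last QFT per hit register.
[folklore] -/
theorem numQft_eq (C : PolyPhaseCircuit r) : C.numQft = C.numVars + C.numHit := by
  induction C with
  | nil => simp [numQft, numVars, numHit]
  | cons g C ih =>
    cases g with
    | kick P =>
      simp only [numQft, numVars, numHit, hasQft_cons_kick] at ih ⊢
      exact ih
    | qft i =>
      simp only [numQft, numVars]
      by_cases hi : hasQft i C = true
      · rw [if_pos hi]
        have : numHit (qft i :: C) = numHit C := by
          unfold numHit
          congr 1
          ext j
          simp only [Finset.mem_filter, Finset.mem_univ, true_and, hasQft_cons_qft,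
            Bool.or_eq_true, decide_eq_true_eq]
          constructor
          · rintro (h | h)
            · rw [← h]; exact hi
            · exact h
          · exact fun h => Or.inr h
        rw [this, ih]; ring
      · rw [if_neg hi]
        have : numHit (qft i :: C) = numHit C + 1 := by
          unfold numHit
          have hset : (Finset.univ.filter fun j => hasQft j (qft i :: C) = true) =
              insert i (Finset.univ.filter fun j => hasQft j C = true) := by
            ext j
            simp only [Finset.mem_filter, Finset.mem_univ, true_and, hasQft_cons_qft,
              Bool.or_eq_true, decide_eq_true_eq, Finset.mem_insert]
            constructor
            · rintro (h | h)
              · exact Or.inl h.symm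
              · exact Or.inr h
            · rintro (h | h)
              · exact Or.inl h.symm
              · exact Or.inr h
          rw [hset, Finset.card_insert_of_notMem]
          simpa using hi
        rw [this, ih]; ring

/-! ### The symbolic path sum -/

/-- **Symbols of the path phase**: `inp j` = the input content `x_j` of register `j`, `out j` = the
output content `y_j`, `pv n` = the `n`-th path variable (content of a register between two
consecutive QFTs on it), numbered `0, 1, …` in order of creation along the circuit. [folklore] -/
inductive Var (r : ℕ) : Type
  /-- input symbol `X_j`. -/
  | inp (j : Fin r) : Var r
  /-- output symbol `Y_j`. -/
  | out (j : Fin r) : Var r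
  /-- path variable `V_n`. -/
  | pv (n : ℕ) : Var r
  deriving DecidableEq

/-- Substitution of the input symbol `X_j` by the polynomial `q` (all other symbols fixed).
[folklore] -/
def substInp (j : Fin r) (q : MvPolynomial (Var r) ℤ) : Var r → MvPolynomial (Var r) ℤ :=
  Function.update MvPolynomial.X (Var.inp j) q

/-- **The path phase, recursively** (`k` = index of the next path variable to be created). Reading
the word from its first gate: a kick `P` contributes `P(X)`; a QFT on register `j` which is NOT the
last QFT on `j` creates the fresh variable `V_k`, contributes `X_j · V_k`, and the rest of the word
sees `V_k` as the input content of register `j`; the LAST QFT on `j` contributes `X_j · Y_j` and the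
rest of the word sees `Y_j` there (its kicks may still read register `j`). [folklore] -/
def phaseAux : ℕ → PolyPhaseCircuit r → MvPolynomial (Var r) ℤ
  | _, [] => 0
  | k, kick P :: C => MvPolynomial.rename Var.inp P + phaseAux k C
  | k, qft j :: C =>
      if hasQft j C then
        X (Var.inp j) * X (Var.pv k) + bind₁ (substInp j (X (Var.pv k))) (phaseAux (k + 1) C)
      else
        X (Var.inp j) * X (Var.out j) + bind₁ (substInp j (X (Var.out j))) (phaseAux k C)

/-- **The path phase `Φ_C ∈ ℤ[X_j, Y_j, V_0, …, V_{K-1}]`** of a circuit: sum of the kicks evaluated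
at the current register contents plus, for every QFT on register `j`, (old content)·(new content).
[folklore] -/
def pathPhase (C : PolyPhaseCircuit r) : MvPolynomial (Var r) ℤ := phaseAux 0 C

/-- Values of the symbols: inputs `x`, outputs `y`, path variables `w`. [folklore] -/
def assign {α : Type*} (x y : Fin r → α) (w : ℕ → α) : Var r → α
  | Var.inp j => x j
  | Var.out j => y j
  | Var.pv n => w n

/-- Place a finite tuple `v` at positions `k, …, k + K - 1` of an environment `ρ : ℕ → α`.
[folklore] -/
def extend {α : Type*} (k : ℕ) (ρ : ℕ → α) {K : ℕ} (v : Fin K → α) : ℕ → α :=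
  fun n => if h : k ≤ n ∧ n - k < K then v ⟨n - k, h.2⟩ else ρ n

/-- **The assignment of a path**: inputs `x`, outputs `y`, path variables `v : Fin K → α` (other
variable indices, which do not occur in `Φ_C`, are sent to `0`). [folklore] -/
def assignment {α : Type*} [Zero α] (C : PolyPhaseCircuit r) (x y : Fin r → α)
    (v : Fin C.numVars → α) : Var r → α :=
  assign x y (extend 0 (fun _ => 0) v)

/-- **The value `Φ_C(x, y, v)` of the path phase** in a commutative ring (e.g. `ℤ/N`). [folklore] -/
def phaseVal {R : Type*} [CommRing R] (C : PolyPhaseCircuit r) (x y : Fin r → R)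
    (v : Fin C.numVars → R) : R :=
  MvPolynomial.aeval (C.assignment x y v) C.pathPhase

/-- **Boundary compatibility**: on registers never Fourier-transformed the content is unchanged,
`x_j = y_j`. [folklore] -/
def Compatible {α : Type*} (C : PolyPhaseCircuit r) (x y : Fin r → α) : Prop :=
  ∀ j, C.hasQft j = false → x j = y j

/-- Compatibility is decidable. [folklore] -/
instance {α : Type*} [DecidableEq α] (C : PolyPhaseCircuit r) (x y : Fin r → α) :
    Decidable (C.Compatible x y) := by
  unfold Compatible; infer_instance

/-- If every register is Fourier-transformed, all boundary data are compatible. [folklore] -/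
theorem compatible_of_forall_hasQft {α : Type*} (C : PolyPhaseCircuit r) (x y : Fin r → α)
    (h : ∀ j, C.hasQft j = true) : C.Compatible x y := by
  intro j hj
  rw [h j] at hj
  exact absurd hj (by decide)

/-- The assignment reads the inputs at input symbols. [folklore] -/
@[simp] theorem assignment_inp {α : Type*} [Zero α] (C : PolyPhaseCircuit r) (x y : Fin r → α)
    (v : Fin C.numVars → α) (j : Fin r) : C.assignment x y v (Var.inp j) = x j := rfl

/-- The assignment reads the outputs at output symbols. [folklore] -/
@[simp] theorem assignment_out {α : Type*} [Zero α] (C : PolyPhaseCircuit r) (x y : Fin r → α)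
    (v : Fin C.numVars → α) (j : Fin r) : C.assignment x y v (Var.out j) = y j := rfl

/-- The assignment reads the tuple `v` at the path variables `V_0, …, V_{K-1}` (and `0` beyond).
[folklore] -/
theorem assignment_pv {α : Type*} [Zero α] (C : PolyPhaseCircuit r) (x y : Fin r → α)
    (v : Fin C.numVars → α) (n : ℕ) :
    C.assignment x y v (Var.pv n) = if h : n < C.numVars then v ⟨n, h⟩ else 0 := by
  simp only [assignment, assign, extend, Nat.zero_le, Nat.sub_zero, true_and]

/-- In particular at an index `i < K`. [folklore] -/
@[simp] theorem assignment_pv_fin {α : Type*} [Zero α] (C : PolyPhaseCircuit r) (x y : Fin r → α)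
    (v : Fin C.numVars → α) (i : Fin C.numVars) :
    C.assignment x y v (Var.pv (i : ℕ)) = v i := by
  rw [assignment_pv, dif_pos i.isLt]

/-- The path sum with an explicit number `K` of variables placed at `k, …, k+K-1` over the
environment `ρ` (induction vehicle for `amplitude_eq_pathSum`). [folklore] -/
def pathSumWith (N : ℕ) [NeZero N] (k K : ℕ) (ρ : ℕ → ZMod N) (Φ : MvPolynomial (Var r) ℤ)
    (x y : Fin r → ZMod N) : ℂ :=
  ∑ v : Fin K → ZMod N, echar N (MvPolynomial.aeval (assign x y (extend k ρ v)) Φ)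

section PathSumLemmas

variable {α : Type*}

/-- A leading kick does not change compatibility. [folklore] -/
theorem compatible_cons_kick_iff (P : MvPolynomial (Fin r) ℤ) (C : PolyPhaseCircuit r)
    (x y : Fin r → α) : Compatible (kick P :: C) x y ↔ Compatible C x y := Iff.rfl

/-- Splitting off the first coordinate of the tuple shifts the window by one. [folklore] -/
theorem extend_cons (k : ℕ) (ρ : ℕ → α) {K : ℕ} (t : α) (v : Fin K → α) :
    extend k ρ (Fin.cons t v : Fin (K + 1) → α) = extend (k + 1) (Function.update ρ k t) v := by
  funext n
  unfold extend
  by_cases h1 : k ≤ n ∧ n - k < K + 1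
  · rw [dif_pos h1]
    by_cases h2 : k + 1 ≤ n ∧ n - (k + 1) < K
    · rw [dif_pos h2]
      have hn : (⟨n - k, h1.2⟩ : Fin (K + 1)) = Fin.succ ⟨n - (k + 1), h2.2⟩ := by
        ext; simp only [Fin.val_succ]; omega
      rw [hn, Fin.cons_succ]
    · rw [dif_neg h2]
      have hnk : n = k := by omega
      have h0 : (⟨n - k, h1.2⟩ : Fin (K + 1)) = 0 := by
        ext; simp only [Fin.val_zero]; omega
      rw [h0, Fin.cons_zero, hnk, Function.update_self]
  · rw [dif_neg h1]
    have h2 : ¬ (k + 1 ≤ n ∧ n - (k + 1) < K) := by omega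
    rw [dif_neg h2, Function.update_of_ne]
    omega

/-- Position `k` lies before a window starting at `k + 1`. [folklore] -/
theorem extend_succ_self (k : ℕ) (ρ : ℕ → α) {K : ℕ} (v : Fin K → α) :
    extend (k + 1) ρ v k = ρ k := by
  unfold extend
  rw [dif_neg]
  omega

/-- Evaluating after the substitution `X_j := q` = evaluating with the input of register `j`
replaced by the value of `q`. [folklore] -/
theorem aeval_substInp {R : Type*} [CommRing R] (j : Fin r) (q : MvPolynomial (Var r) ℤ)
    (x y : Fin r → R) (w : ℕ → R) (Φ : MvPolynomial (Var r) ℤ) :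
    MvPolynomial.aeval (assign x y w) (bind₁ (substInp j q) Φ) =
      MvPolynomial.aeval (assign (Function.update x j (MvPolynomial.aeval (assign x y w) q)) y w) Φ := by
  rw [aeval_bind₁]
  have key : (fun i => MvPolynomial.aeval (assign x y w) (substInp j q i)) =
      assign (Function.update x j (MvPolynomial.aeval (assign x y w) q)) y w := by
    funext i
    unfold substInp
    by_cases hi : i = Var.inp j
    · subst hi
      rw [Function.update_self]
      simp [assign]
    · rw [Function.update_of_ne hi, aeval_X]
      cases i with
      | inp j' =>
        have hj : j' ≠ j := fun h => hi (by rw [h])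
        simp [assign, Function.update_of_ne hj]
      | out j' => rfl
      | pv n => rfl
  rw [key]

/-- A kick written in the input symbols evaluates to `P(x)`. [folklore] -/
theorem aeval_rename_inp {R : Type*} [CommRing R] (P : MvPolynomial (Fin r) ℤ)
    (x y : Fin r → R) (w : ℕ → R) :
    MvPolynomial.aeval (assign x y w) (MvPolynomial.rename Var.inp P) = MvPolynomial.aeval x P := by
  rw [aeval_rename]
  rfl

variable {N : ℕ} [NeZero N]

/-- Peeling the first path variable off `pathSumWith`. [folklore] -/
theorem pathSumWith_succ (k K : ℕ) (ρ : ℕ → ZMod N) (Φ : MvPolynomial (Var r) ℤ)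
    (x y : Fin r → ZMod N) :
    pathSumWith N k (K + 1) ρ Φ x y =
      ∑ t : ZMod N, pathSumWith N (k + 1) K (Function.update ρ k t) Φ x y := by
  unfold pathSumWith
  rw [← (Fin.consEquiv fun _ : Fin (K + 1) => ZMod N).sum_comp, Fintype.sum_prod_type]
  refine Finset.sum_congr rfl fun t _ => Finset.sum_congr rfl fun v _ => ?_
  simp only [Fin.consEquiv, Equiv.coe_fn_mk, extend_cons]

/-- **Incompatible boundary data give amplitude zero**: if some register never touched by a QFT has
`x_j ≠ y_j` then `⟨y|U_C|x⟩ = 0`. [folklore] -/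
theorem amplitude_eq_zero_of_not_compatible (C : PolyPhaseCircuit r) (x y : Fin r → ZMod N)
    (h : ¬ C.Compatible x y) : amplitude N C x y = 0 := by
  induction C generalizing x with
  | nil =>
    rw [amplitude_nil, if_neg]
    intro hxy
    exact h fun j _ => by rw [hxy]
  | cons g C ih =>
    cases g with
    | kick P => rw [amplitude_cons_kick, ih x h, mul_zero]
    | qft j =>
      rw [amplitude_cons_qft]
      convert mul_zero (qftNorm N)
      refine Finset.sum_eq_zero fun t _ => ?_
      rw [ih (Function.update x j t), mul_zero]
      intro hC
      apply h
      intro i hi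
      have hij : i ≠ j := by
        rintro rfl
        simp at hi
      rw [hasQft_cons_qft_of_ne (Ne.symm hij)] at hi
      rw [← hC i hi, Function.update_of_ne hij]

/-- The path-sum identity with an explicit environment (induction vehicle). [folklore] -/
theorem amplitude_eq_pathSumWith (C : PolyPhaseCircuit r) :
    ∀ (k : ℕ) (ρ : ℕ → ZMod N) (x y : Fin r → ZMod N), C.Compatible x y →
      amplitude N C x y = qftNorm N ^ C.numQft * pathSumWith N k C.numVars ρ (phaseAux k C) x y := by
  induction C with
  | nil =>
    intro k ρ x y h
    have hxy : x = y := funext fun j => h j rfl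
    simp [amplitude_nil, hxy, numQft, numVars, pathSumWith, phaseAux]
  | cons g C ih =>
    intro k ρ x y h
    cases g with
    | kick P =>
      rw [amplitude_cons_kick, ih k ρ x y h]
      simp only [numQft, numVars, pathSumWith, phaseAux, map_add, aeval_rename_inp, echar_add,
        Finset.mul_sum]
      refine Finset.sum_congr rfl fun v _ => ?_
      ring
    | qft j =>
      rw [amplitude_cons_qft]
      by_cases hq : hasQft j C = true
      · -- not the last QFT on register `j`: a fresh path variable `V_k`
        have hK : numVars (qft j :: C) = numVars C + 1 := by simp [numVars, hq]
        have hΦ : phaseAux k (qft j :: C) =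
            X (Var.inp j) * X (Var.pv k) + bind₁ (substInp j (X (Var.pv k))) (phaseAux (k + 1) C) := by
          simp [phaseAux, hq]
        rw [hK, hΦ, pathSumWith_succ, Finset.mul_sum, Finset.mul_sum]
        refine Finset.sum_congr rfl fun t _ => ?_
        have hc : Compatible C (Function.update x j t) y := by
          intro i hi
          have hij : i ≠ j := by rintro rfl; rw [hq] at hi; exact Bool.noConfusion hi
          rw [Function.update_of_ne hij]
          exact h i (by rw [hasQft_cons_qft_of_ne (Ne.symm hij)]; exact hi)
        rw [ih (k + 1) (Function.update ρ k t) (Function.update x j t) y hc]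
        simp only [numQft, pathSumWith, Finset.mul_sum]
        refine Finset.sum_congr rfl fun v _ => ?_
        rw [map_add, map_mul, aeval_X, aeval_X, aeval_substInp, aeval_X, echar_add]
        simp only [assign, extend_succ_self, Function.update_self]
        ring
      · -- the last QFT on register `j`: the new content is the output `y_j`
        have hq' : hasQft j C = false := by simpa using hq
        have hK : numVars (qft j :: C) = numVars C := by simp [numVars, hq']
        have hΦ : phaseAux k (qft j :: C) =
            X (Var.inp j) * X (Var.out j) + bind₁ (substInp j (X (Var.out j))) (phaseAux k C) := by
          simp [phaseAux, hq']
        rw [hK, hΦ]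
        rw [Finset.sum_eq_single (y j)]
        · have hc : Compatible C (Function.update x j (y j)) y := by
            intro i hi
            by_cases hij : i = j
            · subst hij; rw [Function.update_self]
            · rw [Function.update_of_ne hij]
              exact h i (by rw [hasQft_cons_qft_of_ne (Ne.symm hij)]; exact hi)
          rw [ih k ρ (Function.update x j (y j)) y hc]
          simp only [numQft, pathSumWith, Finset.mul_sum]
          refine Finset.sum_congr rfl fun v _ => ?_
          rw [map_add, map_mul, aeval_X, aeval_X, aeval_substInp, aeval_X, echar_add]
          simp only [assign]
          ring
        · intro t _ ht
          rw [amplitude_eq_zero_of_not_compatible, mul_zero]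
          intro hc
          exact ht (by rw [← hc j hq', Function.update_self])
        · intro hy
          exact absurd (Finset.mem_univ _) hy

end PathSumLemmas

/-- **THE PATH SUM.** For boundary-compatible `x, y`:
`⟨y|U_C|x⟩ = N^{-#F/2} · ∑_{v ∈ (ℤ/N)^K} e(Φ_C(x, y, v)/N)`, one summation variable per QFT that is
not the last on its register, `Φ_C` the path phase. (Incompatible data:
`amplitude_eq_zero_of_not_compatible`.) [folklore] -/
theorem amplitude_eq_pathSum {N : ℕ} [NeZero N] (C : PolyPhaseCircuit r) (x y : Fin r → ZMod N)
    (h : C.Compatible x y) :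
    amplitude N C x y = qftNorm N ^ C.numQft * ∑ v : Fin C.numVars → ZMod N, echar N (C.phaseVal x y v) :=
  amplitude_eq_pathSumWith C 0 (fun _ => 0) x y h

/-- **Sanity: the empty word** has no variables, phase `0`, and amplitude `δ_{xy}`. [folklore] -/
theorem pathPhase_nil : pathPhase ([] : PolyPhaseCircuit r) = 0 := rfl

/-- **Sanity: one kick** has path phase `P(X)`. [folklore] -/
theorem pathPhase_kick (P : MvPolynomial (Fin r) ℤ) :
    pathPhase [kick P] = MvPolynomial.rename Var.inp P + 0 := rfl

/-- **Sanity: one QFT** on register `j` has no path variable and path phase `X_j Y_j`. [folklore] -/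
theorem pathPhase_qft (j : Fin r) :
    pathPhase [qft j] = X (Var.inp j) * X (Var.out j) + 0 := by
  simp [pathPhase, phaseAux, hasQft]

/-- **Sanity: `F D_P F` on one register** has exactly one path variable `V_0` (created by the
first QFT, consumed by the last) and path phase `X_0 V_0 + P(V_0) + V_0 Y_0` — the phase of
`⟨y|F D_P F|x⟩ = N^{-1} ∑_v e((x v + P(v) + v y)/N)`. [folklore] -/
theorem pathPhase_qft_kick_qft (P : MvPolynomial (Fin 1) ℤ) :
    pathPhase ([qft 0, kick P, qft 0] : PolyPhaseCircuit 1) =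
      X (Var.inp 0) * X (Var.pv 0) +
        (MvPolynomial.rename (fun _ => Var.pv 0) P + (X (Var.pv 0) * X (Var.out 0) + 0)) := by
  simp [pathPhase, phaseAux, hasQft, substInp, map_add, map_mul, bind₁_X_right, Function.update,
    MvPolynomial.bind₁_rename]
  have h : (Function.update X (Var.inp 0) (X (Var.pv 0)) ∘ Var.inp : Fin 1 → MvPolynomial (Var 1) ℤ) =
      X ∘ (fun _ => Var.pv 0) := by
    funext i
    rw [Subsingleton.elim i 0]
    simp
  rw [h, MvPolynomial.rename_eq_aeval]
  rfl

/-! ### Register bookkeeping: first variables -/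

/-- `firstVarAux k C j` = index of the path variable created by the FIRST QFT on register `j` in
`C` (numbering from `k`), or `none` if register `j` carries no path variable (at most one QFT on
it). [folklore] -/
def firstVarAux : ℕ → PolyPhaseCircuit r → Fin r → Option ℕ
  | _, [], _ => none
  | k, kick _ :: C, j => firstVarAux k C j
  | k, qft i :: C, j =>
      if hasQft i C then (if i = j then some k else firstVarAux (k + 1) C j)
      else (if i = j then none else firstVarAux k C j)

/-- **First variable of each register**: the index `n` of the path variable `V_n` created by the
first QFT on register `j`, if register `j` is Fourier-transformed at least twice (`none` otherwise).
In the route's triangularity argument a critical point is determined by the values of these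
variables. [folklore] -/
def firstVar (C : PolyPhaseCircuit r) (j : Fin r) : Option ℕ := firstVarAux 0 C j

/-! ### The 2-adic layer `N = 4^c` -/

section TwoAdic

variable (c : ℕ)

/-- `2^c ∣ 4^c`. [folklore] -/
theorem two_pow_dvd_four_pow : 2 ^ c ∣ 4 ^ c :=
  pow_dvd_pow_of_dvd (by norm_num) c

/-- Reduction `ℤ/4^c → ℤ/2^c`. [folklore] -/
def halfRed : ZMod (4 ^ c) →+* ZMod (2 ^ c) :=
  ZMod.castHom (two_pow_dvd_four_pow c) (ZMod (2 ^ c))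

/-- Least-residue lift `ℤ/2^c → ℤ/4^c`, `a ↦ ã := (a.val : ℤ/4^c)` (the lift used in the route's
statements). [folklore] -/
def liftHalf (a : ZMod (2 ^ c)) : ZMod (4 ^ c) := ((a.val : ℕ) : ZMod (4 ^ c))

/-- `halfRed (liftHalf a) = a`. [folklore] -/
theorem halfRed_liftHalf (a : ZMod (2 ^ c)) : halfRed c (liftHalf c a) = a := by
  simp [halfRed, liftHalf]

/-- **Critical points** of the path phase at 2-adic precision `c`: `a ∈ (ℤ/2^c)^K` (with the
boundary data reduced mod `2^c`) is critical iff every partial derivative `∂Φ_C/∂V_n`, `n < K`,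
vanishes in `ℤ/2^c` — the critical set `∇Φ ≡ 0 (mod p^{min(j, m-j)})` of the periodized stationary
phase at `p = 2`, `m = 2c`, `j = c`. [cite: KociaLove2021, §5 Thm 1(a)] -/
def IsCritical (C : PolyPhaseCircuit r) (x y : Fin r → ZMod (4 ^ c))
    (a : Fin C.numVars → ZMod (2 ^ c)) : Prop :=
  ∀ i : Fin C.numVars,
    MvPolynomial.aeval (C.assignment (halfRed c ∘ x) (halfRed c ∘ y) a)
      (MvPolynomial.pderiv (Var.pv (i : ℕ)) C.pathPhase) = 0

/-- Criticality is decidable (so that `if C.IsCritical c x y a then … else 0` and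
`Finset.filter` can be written in statements). [folklore] -/
instance (C : PolyPhaseCircuit r) (x y : Fin r → ZMod (4 ^ c)) (a : Fin C.numVars → ZMod (2 ^ c)) :
    Decidable (C.IsCritical c x y a) := by
  unfold IsCritical; infer_instance

/-- The path sum on `ℤ/4^c` with the route's normalisation `2^{-c·#F}`. [folklore] -/
theorem amplitude_eq_pathSum_four_pow (C : PolyPhaseCircuit r) (x y : Fin r → ZMod (4 ^ c))
    (h : C.Compatible x y) :
    amplitude (4 ^ c) C x y =
      ((2 : ℂ) ^ c)⁻¹ ^ C.numQft * ∑ v : Fin C.numVars → ZMod (4 ^ c), echar (4 ^ c) (C.phaseVal x y v) := by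
  rw [amplitude_eq_pathSum C x y h, qftNorm_four_pow]

end TwoAdic

/-! ### One register: the alternating word and the chain sum -/

section Chain

/-- **The one-register alternating word** `D_{P_0} F D_{P_1} F ⋯ D_{P_k} F` (kick `P_0` applied
first, every kick followed by a QFT) of univariate integer kicks `P_0, …, P_k`. [folklore] -/
def chain : (k : ℕ) → (Fin (k + 1) → Polynomial ℤ) → PolyPhaseCircuit 1
  | 0, P => [kick ((P 0).toMvPolynomial 0), qft 0]
  | k + 1, P => kick ((P 0).toMvPolynomial 0) :: qft 0 :: chain k (fun i => P i.succ)

variable {N : ℕ}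

/-- On one register, updating register `0` replaces the whole state. [folklore] -/
theorem update_const_fin_one (x t : ZMod N) :
    Function.update (fun _ : Fin 1 => x) 0 t = fun _ => t := by
  funext i
  rw [Subsingleton.elim i 0, Function.update_self]

/-- One-register states are equal iff their single entries are. [folklore] -/
theorem const_fin_one_eq_iff (t y : ZMod N) : ((fun _ : Fin 1 => t) = fun _ => y) ↔ t = y :=
  ⟨fun h => congrFun h 0, fun h => by rw [h]⟩

/-- A univariate kick on one register evaluates as the route writes it:
`((P).map (Int.castRingHom _)).eval (u 0)`. [folklore] -/
theorem aeval_toMvPolynomial_fin_one (p : Polynomial ℤ) (u : Fin 1 → ZMod N) :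
    MvPolynomial.aeval u (p.toMvPolynomial (0 : Fin 1)) =
      (p.map (Int.castRingHom (ZMod N))).eval (u 0) := by
  rw [MvPolynomial.aeval_toMvPolynomial, Polynomial.eval_map, Polynomial.aeval_def, algebraMap_int_eq]

/-- `Fin.snoc` of the empty tuple is constant. [folklore] -/
theorem snoc_fin_zero {α : Type*} (q : Fin 0 → α) (y : α) (i : Fin 1) :
    (Fin.snoc q y : Fin 1 → α) i = y := by
  rw [Subsingleton.elim i (Fin.last 0), Fin.snoc_last]

variable [NeZero N]

/-- **The chain sum (general modulus).** For the alternating word,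
`⟨y| F D_{P_k} ⋯ F D_{P_0} |x⟩ = N^{-(k+1)/2} ∑_{v ∈ (ℤ/N)^k} e(Φ(v)/N)`,
`Φ(v) = ∑_{i=0}^{k} P_i(w_i) + w_i w_{i+1}`, `w = (x, v_0, …, v_{k-1}, y)`. [folklore] -/
theorem amplitude_chain_echar (k : ℕ) (P : Fin (k + 1) → Polynomial ℤ) (x y : ZMod N) :
    amplitude N (chain k P) (fun _ => x) (fun _ => y) =
      qftNorm N ^ (k + 1) * ∑ v : Fin k → ZMod N, echar N
        (∑ i : Fin (k + 1), (((P i).map (Int.castRingHom (ZMod N))).eval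
          ((Fin.cons x (Fin.snoc v y) : Fin (k + 2) → ZMod N) i.castSucc) +
          (Fin.cons x (Fin.snoc v y) : Fin (k + 2) → ZMod N) i.castSucc *
          (Fin.cons x (Fin.snoc v y) : Fin (k + 2) → ZMod N) i.succ)) := by
  induction k generalizing x with
  | zero =>
    simp only [chain, amplitude_cons_kick, amplitude_cons_qft, amplitude_nil, update_const_fin_one,
      const_fin_one_eq_iff, mul_ite, mul_one, mul_zero, Finset.sum_ite_eq', Finset.mem_univ,
      if_true, aeval_toMvPolynomial_fin_one]
    rw [Fintype.sum_unique, Fin.sum_univ_one, pow_one]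
    simp only [Fin.castSucc_zero, Fin.cons_zero, Fin.succ_zero_eq_one, Fin.cons_one, snoc_fin_zero,
      echar_add]
    ring
  | succ k ih =>
    simp only [chain, amplitude_cons_kick, amplitude_cons_qft, update_const_fin_one,
      aeval_toMvPolynomial_fin_one]
    simp_rw [ih]
    rw [← (Fin.consEquiv fun _ : Fin (k + 1) => ZMod N).sum_comp, Fintype.sum_prod_type]
    simp only [Fin.consEquiv, Equiv.coe_fn_mk, Finset.mul_sum]
    refine Finset.sum_congr rfl fun t _ => Finset.sum_congr rfl fun v _ => ?_
    rw [Fin.sum_univ_succ (n := k + 1), ← Fin.cons_snoc_eq_snoc_cons]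
    simp only [Fin.castSucc_zero, Fin.cons_zero, Fin.succ_zero_eq_one, Fin.castSucc_succ,
      Fin.cons_succ]
    have h1 : (Fin.cons x (Fin.cons t (Fin.snoc v y)) : Fin (k + 3) → ZMod N) 1 = t := rfl
    rw [h1, echar_add, echar_add]
    ring

/-- **THE CHAIN SUM on `ℤ/4^c`, verbatim as in route QuantumAdvantage/TwoAdicStationaryPhase**
(decls `TspChainLocalisation`, `TspAmplitudeAverage`, with `x y` there the casts of integers):
`⟨y| F D_{P_k} ⋯ F D_{P_0} |x⟩ = (2^c)^{-(k+1)} ∑_{v ∈ (ℤ/4^c)^k} exp(2πi Φ(v).val / 4^c)`. [folklore] -/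
theorem amplitude_chain (c k : ℕ) (P : Fin (k + 1) → Polynomial ℤ) (x y : ZMod (4 ^ c)) :
    amplitude (4 ^ c) (chain k P) (fun _ => x) (fun _ => y) =
      ((2 : ℂ) ^ c)⁻¹ ^ (k + 1) * (∑ v : Fin k → ZMod (4 ^ c), Complex.exp (2 * Real.pi * Complex.I *
        ((((∑ i : Fin (k + 1), (((P i).map (Int.castRingHom (ZMod (4 ^ c)))).eval
          ((Fin.cons x (Fin.snoc v y) : Fin (k + 2) → ZMod (4 ^ c)) i.castSucc) +
          (Fin.cons x (Fin.snoc v y) : Fin (k + 2) → ZMod (4 ^ c)) i.castSucc *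
          (Fin.cons x (Fin.snoc v y) : Fin (k + 2) → ZMod (4 ^ c)) i.succ))).val : ℂ) /
            (4 ^ c : ℂ)))) := by
  rw [amplitude_chain_echar, qftNorm_four_pow]
  simp_rw [echar_four_pow]

end Chain

end PolyPhaseCircuit

end Literature.Computability.QuantumComplexity
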